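import Summits.NavierStokesRegularity.FunctionalMining.NoGo.TopBotEigSplitShareWallLine
import Mathlib.Analysis.Convex.SpecificFunctions.Pow
import Mathlib.Analysis.Complex.ExponentialBounds
import HarnessLib

/-!
# K25 — the two side conditions of the one-dimensional wall criterion hold for EVERY real `q ≥ 2` and every share
# `c < B_q` (resp. `c ≤ B_q`) — in particular at the sharp share `c = c_axi(q) < B_q`:
# (N⁺) `N > 0` and (D) `c(3u − 1)‖A(u)‖^{q−2} ≤ u^{q−1}` on `[1/3, 2/3]`

search for candidate a priori estimates; no regularity claim.

Pure one-variable real analysis over the TREE toolkit K16 part 1 (`NoGo.TopBotEigSplitShareWallLine`), Mathlib only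
(`one_add_mul_self_le_rpow_one_add` = Bernoulli for real exponents, `Real.concaveOn_rpow`, `convexOn_rpow`,
`Real.add_one_le_exp`, `Real.log_two_gt_d9`). K19's sufficiency criterion `topBotEigSplitting_of_line` (staged) asks, at a
share `c ≥ 0` and for `u ∈ [1/3, 2/3]`, for (N⁺) `0 < lineN q c u`, (D) `c(3u−1)·lineNsq u^{q/2−1} ≤ u^{q−1}` and (W)
`0 ≤ lineT q c u`. The bricks K17/K21/K22/K23 verified (N⁺) and (D) exponent by exponent (`q = 4, 3, 6, 8`) from decimal
windows for `c_axi(q)`. Here both are proved ONCE for every real `q ≥ 2`, at every share below the dictionary constant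
`B_q = ((q−1)/2)·6^{1−q/2} = 3(q−1)/(2^{q/2}3^{q/2})`:

§1 `cAxi_lt_axiB : c_axi(q) < B_q` (`q > 1`; the mirror image of K16's `cAxi_lt_axiS`), `axiB_pos`;
§2 the elementary inequality `self_le_three_halves_rpow : x ≤ (3/2)^x` for real `x ≥ 1` (Bernoulli on three ranges);
§3 **(N⁺) `lineN_pos_of_lt_axiB`**: `2 ≤ q`, `c < B_q` ⟹ `0 < lineN q c u` on `[1/3, 2/3]` (`u^q + (1−u)^q ≥ 2^{1−q}` by
convexity, `‖A(u)‖² ≤ 2/3`, and `3(q−1)·2^q ≤ 2·3^q` from §2);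
§4 **(D) `lineD_of_le_axiB`**: `2 ≤ q`, `c ≤ B_q` ⟹ `c(3u−1)·lineNsq u^{q/2−1} ≤ u^{q−1}` on `[1/3, 2/3]` (with `t = 6u²/s ∈ [1, 4]`,
`s = ‖A(u)‖²`, the claim is `3(q−1)(3u−1) ≤ 6u·t^{q/2−1}`; for `q ≥ 4` Bernoulli `t^a ≥ 1 + a(t−1)` and `s ≤ 2u`; for
`2 ≤ q < 4` the chord of the concave `t ↦ t^a` on `[1, 4]`, `4^a = 2^{q−2} ≥ 1 + (2/3)(q−2)`, and a cubic in `u` affine in `q`);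
§5 the two conditions AT `c = c_axi(q)` for every real `q ≥ 2`: `lineN_cAxi_pos`, `lineD_cAxi`.

With K24 (`lineT_cAxi_nonneg_of_wallRhoConcave`) this leaves, for every real `q ≥ 2`, exactly ONE one-variable statement
between the tree and the share window `Iic (c_axi q)`: the concavity (W⋆) of `wallRho q (c_axi q)` on `[1/3, 2/3]` (K24 §4).
NOT claimed: (W) or `TopBotEigSplitting q (c_axi q)` for any new `q`; nothing on `heatDissipation`.
search for candidate a priori estimates; no regularity claim.
FILING (prove seat g27, REQUEST #41): declarations byte-identical to the no-go seat's staged `TopBotEigSplitWallSides.STAGING.lean` 305abb9dc3be3d39; this line is the only addition.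
-/

open Set

noncomputable section

namespace Summit.NavierStokesRegularity.FunctionalMining

namespace TopEig

/-! ## 1. `c_axi(q) < B_q` -/

/-- **`c_axi(q) < B_q`** for `q > 1`. [ours] -/
theorem cAxi_lt_axiB {q : ℝ} (hq : 1 < q) : cAxi q < axiB q := by
  have h1 : |axiS q - axiB q| < Real.sqrt ((axiS q - axiB q) ^ 2 + 4 * axiR q) :=
    Real.lt_sqrt_of_sq_lt (by rw [sq_abs]; exact axi_disc_gt hq)
  have h2 : axiS q - axiB q ≤ |axiS q - axiB q| := le_abs_self _
  rw [cAxi]; linarith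

/-- `0 < B_q` for `q > 1`. [bookkeeping] -/
theorem axiB_pos {q : ℝ} (hq : 1 < q) : 0 < axiB q := by
  rw [axiB_eq]; have hP := axiP_pos q; have hQ := axiQ_pos q; exact div_pos (by linarith) (by positivity)

/-! ## 2. `x ≤ (3/2)^x` for real `x ≥ 1` -/

/-- Bernoulli at `s = 1/2`: `1 + p/2 ≤ (3/2)^p` for `p ≥ 1`. [bookkeeping] -/
theorem one_add_half_mul_le_rpow {p : ℝ} (hp : 1 ≤ p) : 1 + p * (1 / 2) ≤ (3 / 2 : ℝ) ^ p := by
  have h := one_add_mul_self_le_rpow_one_add (show (-1 : ℝ) ≤ 1 / 2 by norm_num) hp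
  norm_num at h ⊢
  exact h

/-- **`x ≤ (3/2)^x` for every real `x ≥ 1`** (Bernoulli on `[1, 2]`, `[2, 3]`, `[3, ∞)`). [ours, bookkeeping] -/
theorem self_le_three_halves_rpow {x : ℝ} (hx : 1 ≤ x) : x ≤ (3 / 2 : ℝ) ^ x := by
  rcases le_or_gt x 2 with h2 | h2
  · have h := one_add_half_mul_le_rpow hx; linarith
  rcases le_or_gt x 3 with h3 | h3
  · have h := one_add_half_mul_le_rpow (show 1 ≤ x - 1 by linarith)
    have e : (3 / 2 : ℝ) ^ x = (3 / 2) ^ (x - 1) * (3 / 2) := by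
      rw [Real.rpow_sub_one (by norm_num : (3 / 2 : ℝ) ≠ 0)]; ring
    rw [e]; nlinarith
  · have h := one_add_half_mul_le_rpow (show 1 ≤ x - 2 by linarith)
    have e : (3 / 2 : ℝ) ^ x = (3 / 2) ^ (x - 2) * (9 / 4) := by
      rw [Real.rpow_sub (by norm_num : (0 : ℝ) < 3 / 2), Real.rpow_two]; ring
    rw [e]; nlinarith

/-- The atom form: `3(q−1)·P² ≤ 2·Q²` (`P = 2^{q/2}`, `Q = 3^{q/2}`), i.e. `3(q−1)2^q ≤ 2·3^q`, for `q ≥ 2`. [bookkeeping] -/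
theorem three_mul_axiP_sq_le {q : ℝ} (hq : 2 ≤ q) : 3 * (q - 1) * axiP q ^ 2 ≤ 2 * axiQ q ^ 2 := by
  have hP := axiP_pos q
  have h := self_le_three_halves_rpow (show 1 ≤ q - 1 by linarith)
  have e : (3 / 2 : ℝ) ^ (q - 1) = 2 / 3 * (axiQ q ^ 2 / axiP q ^ 2) := by
    rw [Real.rpow_sub_one (by norm_num : (3 / 2 : ℝ) ≠ 0), Real.div_rpow (by norm_num : (0 : ℝ) ≤ 3) zero_le_two,
      three_rpow_axi, two_rpow_axi]
    ring
  rw [e, show 2 / 3 * (axiQ q ^ 2 / axiP q ^ 2) = 2 * axiQ q ^ 2 / (3 * axiP q ^ 2) by ring,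
    le_div_iff₀ (by positivity)] at h
  linarith

/-! ## 3. (N⁺) for every real `q ≥ 2` and every share `c < B_q` -/

/-- `u^q + (1−u)^q ≥ 2·(1/2)^q` on `[0, 1]`, `q ≥ 1` (convexity of `x ↦ x^q`). [bookkeeping] -/
theorem two_mul_half_rpow_le {q : ℝ} (hq : 1 ≤ q) {u : ℝ} (hu0 : 0 ≤ u) (hu1 : u ≤ 1) :
    2 * (1 / 2 : ℝ) ^ q ≤ u ^ q + (1 - u) ^ q := by
  have h := (convexOn_rpow hq).2 (Set.mem_Ici.mpr hu0) (Set.mem_Ici.mpr (by linarith : (0 : ℝ) ≤ 1 - u))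
    (by norm_num : (0 : ℝ) ≤ 1 / 2) (by norm_num : (0 : ℝ) ≤ 1 / 2) (by norm_num)
  simp only [smul_eq_mul] at h
  rw [show (1 / 2 : ℝ) * u + 1 / 2 * (1 - u) = 1 / 2 by ring] at h
  linarith

/-- `(1/2)^q = 1/P²`. [bookkeeping] -/
theorem half_rpow_axi (q : ℝ) : (1 / 2 : ℝ) ^ q = 1 / axiP q ^ 2 := by
  rw [Real.div_rpow zero_le_one zero_le_two, Real.one_rpow, two_rpow_axi]

/-- `‖A(u)‖² ≤ 2/3` on `[1/3, 2/3]`. [bookkeeping] -/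
theorem lineNsq_le_two_thirds {u : ℝ} (hu1 : 1 / 3 ≤ u) (hu2 : u ≤ 2 / 3) : lineNsq u ≤ 2 / 3 := by
  unfold lineNsq; nlinarith [mul_nonneg (sub_nonneg.2 hu1) (sub_nonneg.2 hu2)]

/-- **(N⁺) for every real `q ≥ 2` and every `c < B_q`**: `0 < N(u) = u^q + (1−u)^q − c‖A(u)‖^q` on `[1/3, 2/3]`
(`N ≥ 2^{1−q} − c(2/3)^{q/2} > 2/P² − B_q·P/Q = 2/P² − 3(q−1)/Q² ≥ 0`). [ours] -/
theorem lineN_pos_of_lt_axiB {q c : ℝ} (hq : 2 ≤ q) (hc : c < axiB q) {u : ℝ} (hu1 : 1 / 3 ≤ u) (hu2 : u ≤ 2 / 3) :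
    0 < lineN q c u := by
  have hP := axiP_pos q; have hQ := axiQ_pos q
  have hq1 : 1 < q := by linarith
  have hs0 := lineNsq_pos u
  have hspos : 0 < lineNsq u ^ (q / 2) := Real.rpow_pos_of_pos hs0 _
  have hs : lineNsq u ^ (q / 2) ≤ axiP q / axiQ q := by
    rw [← twoThirds_rpow_half]
    exact Real.rpow_le_rpow hs0.le (lineNsq_le_two_thirds hu1 hu2) (by linarith)
  have h1 : 2 * (1 / axiP q ^ 2) ≤ u ^ q + (1 - u) ^ q := by
    rw [← half_rpow_axi]; exact two_mul_half_rpow_le hq1.le (by linarith) (by linarith)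
  have hc' : c * lineNsq u ^ (q / 2) < axiB q * (axiP q / axiQ q) :=
    calc c * lineNsq u ^ (q / 2) < axiB q * lineNsq u ^ (q / 2) := mul_lt_mul_of_pos_right hc hspos
      _ ≤ axiB q * (axiP q / axiQ q) := mul_le_mul_of_nonneg_left hs (axiB_pos hq1).le
  have hval : axiB q * (axiP q / axiQ q) = 3 * (q - 1) / axiQ q ^ 2 := by
    rw [axiB_eq]; field_simp
  have hkey : 3 * (q - 1) / axiQ q ^ 2 ≤ 2 * (1 / axiP q ^ 2) := by
    rw [show 2 * (1 / axiP q ^ 2) = 2 / axiP q ^ 2 by ring, div_le_div_iff₀ (by positivity) (by positivity)]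
    linarith [three_mul_axiP_sq_le hq]
  rw [hval] at hc'
  rw [lineN]
  linarith

/-! ## 4. (D) for every real `q ≥ 2` and every share `c ≤ B_q` -/

/-- The cubic of the low range: `0 ≤ 6u·s − 9(3u−1)·s + (16/3)u(3u−1)` on `u ≤ 2/3` (`s = 6u² − 6u + 2`;
`= (2/3 − u)(126(u − 4/9)² + 16/9) + 2/9`). [bookkeeping] -/
theorem lineD_cubic_nonneg {u : ℝ} (hu2 : u ≤ 2 / 3) :
    0 ≤ 6 * u * lineNsq u - 9 * (3 * u - 1) * lineNsq u + 16 / 3 * u * (3 * u - 1) := by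
  unfold lineNsq
  nlinarith [mul_nonneg (sub_nonneg.2 hu2) (sq_nonneg (u - 4 / 9)), sub_nonneg.2 hu2]

/-- **(D) at the share `B_q`, every real `q ≥ 2`**: `B_q(3u−1)‖A(u)‖^{q−2} ≤ u^{q−1}` on `[1/3, 2/3]`. [ours] -/
theorem lineD_axiB {q : ℝ} (hq : 2 ≤ q) {u : ℝ} (hu1 : 1 / 3 ≤ u) (hu2 : u ≤ 2 / 3) :
    axiB q * (3 * u - 1) * lineNsq u ^ (q / 2 - 1) ≤ u ^ (q - 1) := by
  have hP := axiP_pos q; have hQ := axiQ_pos q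
  have hu0 : 0 < u := by linarith
  have hy : 0 ≤ 3 * u - 1 := by linarith
  have hs := lineNsq_pos u
  have hx0 : 0 ≤ q - 2 := by linarith
  set a := q / 2 - 1 with ha_def
  have ha : 0 ≤ a := by linarith
  set t := 6 * u ^ 2 / lineNsq u with ht_def
  have ht1 : 1 ≤ t := by rw [ht_def, le_div_iff₀ hs]; unfold lineNsq; nlinarith
  have ht4 : t ≤ 4 := by rw [ht_def, div_le_iff₀ hs]; unfold lineNsq; nlinarith [sq_nonneg (3 * u - 2)]
  have htm1 : t - 1 = 2 * (3 * u - 1) / lineNsq u := by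
    rw [ht_def, eq_div_iff hs.ne']; field_simp; unfold lineNsq; ring
  -- the core inequality `3(q−1)(3u−1) ≤ 6u·t^a`
  have core : 3 * (q - 1) * (3 * u - 1) ≤ 6 * u * t ^ a := by
    rcases le_or_gt 1 a with ha1 | ha1
    · -- `q ≥ 4`: Bernoulli `t^a ≥ 1 + a(t − 1)` and `s ≤ 2u`
      have hb : 1 + a * (t - 1) ≤ t ^ a := by
        have h := one_add_mul_self_le_rpow_one_add (show (-1 : ℝ) ≤ t - 1 by linarith) ha1
        rwa [add_sub_cancel] at h
      have h2u : 1 ≤ 2 * u / lineNsq u := by rw [le_div_iff₀ hs]; unfold lineNsq; nlinarith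
      have h3 : 6 * a * (3 * u - 1) ≤ 6 * u * (a * (t - 1)) := by
        rw [htm1, show 6 * u * (a * (2 * (3 * u - 1) / lineNsq u)) = 6 * a * (3 * u - 1) * (2 * u / lineNsq u) by ring]
        have h0 : 0 ≤ 6 * a * (3 * u - 1) := by positivity
        nlinarith [mul_le_mul_of_nonneg_left h2u h0]
      have h4 : 6 * u * (1 + a * (t - 1)) ≤ 6 * u * t ^ a := mul_le_mul_of_nonneg_left hb (by linarith)
      have h5 : 6 * a = 3 * (q - 2) := by rw [ha_def]; ring
      nlinarith [h3, h4, h5]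
    · -- `2 ≤ q < 4`: the chord of the concave `t ↦ t^a` on `[1, 4]`, and `4^a = 2^{q−2} ≥ 1 + (2/3)(q − 2)`
      have hch : 1 + (t - 1) * ((4 : ℝ) ^ a - 1) / 3 ≤ t ^ a := by
        have h := (Real.concaveOn_rpow ha ha1.le).2 (Set.mem_Ici.mpr (zero_le_one : (0 : ℝ) ≤ 1))
          (Set.mem_Ici.mpr (by norm_num : (0 : ℝ) ≤ 4)) (show 0 ≤ (4 - t) / 3 by linarith)
          (show 0 ≤ (t - 1) / 3 by linarith) (by ring)
        simp only [smul_eq_mul, Real.one_rpow] at h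
        rw [show (4 - t) / 3 * 1 + (t - 1) / 3 * 4 = t by ring] at h
        linarith
      have hK : 1 + 2 / 3 * (q - 2) ≤ (4 : ℝ) ^ a := by
        rw [Real.rpow_def_of_pos (by norm_num : (0 : ℝ) < 4)]
        have hl : Real.log 4 = 2 * Real.log 2 := by
          rw [show (4 : ℝ) = 2 ^ 2 by norm_num, Real.log_pow]; push_cast; ring
        have h2 := Real.log_two_gt_d9
        have he := Real.add_one_le_exp (Real.log 4 * a)
        have hm : 2 / 3 * (q - 2) ≤ Real.log 4 * a := by
          rw [hl, ha_def]; nlinarith [mul_le_mul_of_nonneg_left h2.le hx0]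
        linarith
      have hx2 : q - 2 ≤ 2 := by rw [ha_def] at ha1; linarith
      -- polynomial step: `3(q−1)(3u−1)·s ≤ 6u·s + (8/3)(q−2)·u(3u−1)` (affine in `q`; checked at `q = 2` and `q = 4`)
      have hG : 3 * (q - 1) * (3 * u - 1) * lineNsq u ≤ 6 * u * lineNsq u + 8 / 3 * (q - 2) * u * (3 * u - 1) := by
        have G0 : 0 ≤ 3 * lineNsq u * (1 - u) := by nlinarith
        have G2 := lineD_cubic_nonneg hu2
        nlinarith [mul_nonneg (sub_nonneg.2 hx2) G0, mul_nonneg hx0 G2]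
      -- `6u·t^a ≥ 6u(1 + (t−1)(4^a − 1)/3) ≥ 6u + (8/3)(q−2)u(3u−1)/s`
      have hlow : 6 * u + 8 / 3 * (q - 2) * u * (3 * u - 1) / lineNsq u ≤ 6 * u * (1 + (t - 1) * ((4 : ℝ) ^ a - 1) / 3) := by
        have hprod : (t - 1) * (2 / 3 * (q - 2)) ≤ (t - 1) * ((4 : ℝ) ^ a - 1) :=
          mul_le_mul_of_nonneg_left (by linarith) (by linarith)
        rw [htm1] at hprod ⊢
        have e : 6 * u + 8 / 3 * (q - 2) * u * (3 * u - 1) / lineNsq u =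
            6 * u * (1 + 2 * (3 * u - 1) / lineNsq u * (2 / 3 * (q - 2)) / 3) := by
          field_simp; ring
        rw [e]
        nlinarith [mul_le_mul_of_nonneg_left hprod (by linarith : (0 : ℝ) ≤ 6 * u)]
      have h4 : 6 * u * (1 + (t - 1) * ((4 : ℝ) ^ a - 1) / 3) ≤ 6 * u * t ^ a :=
        mul_le_mul_of_nonneg_left hch (by linarith)
      have hdiv : 3 * (q - 1) * (3 * u - 1) ≤ 6 * u + 8 / 3 * (q - 2) * u * (3 * u - 1) / lineNsq u := by
        rw [add_div' _ _ _ hs.ne', le_div_iff₀ hs]; linarith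
      linarith
  -- undo the normalisation: `B_q = 3(q−1)/(6·6^a)`, `u^{q−1} = u·(u²)^a`, `t^a = 6^a (u²)^a / s^a`
  have hsa : 0 < lineNsq u ^ a := Real.rpow_pos_of_pos hs a
  have h6a : 0 < (6 : ℝ) ^ a := Real.rpow_pos_of_pos (by norm_num) a
  have e6 : axiP q * axiQ q = 6 * (6 : ℝ) ^ a := by
    rw [← six_rpow_half, show q / 2 = a + 1 by rw [ha_def]; ring, Real.rpow_add (by norm_num : (0 : ℝ) < 6),
      Real.rpow_one]; ring
  have eu : u ^ (q - 1) = u * (u ^ 2) ^ a := by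
    rw [← Real.rpow_two, ← Real.rpow_mul hu0.le, show (2 : ℝ) * a = q - 2 by rw [ha_def]; ring,
      show q - 1 = q - 2 + 1 by ring, Real.rpow_add hu0, Real.rpow_one, mul_comm]
  rw [ht_def, Real.div_rpow (by positivity : (0 : ℝ) ≤ 6 * u ^ 2) hs.le,
    Real.mul_rpow (by norm_num : (0 : ℝ) ≤ 6) (sq_nonneg u)] at core
  have key : 3 * (q - 1) * (3 * u - 1) * lineNsq u ^ a ≤ 6 * u * (6 : ℝ) ^ a * (u ^ 2) ^ a := by
    have h := mul_le_mul_of_nonneg_right core hsa.le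
    have e : 6 * u * ((6 : ℝ) ^ a * (u ^ 2) ^ a / lineNsq u ^ a) * lineNsq u ^ a = 6 * u * 6 ^ a * (u ^ 2) ^ a := by
      field_simp
    linarith [h, e]
  rw [axiB_eq, e6, eu, div_mul_eq_mul_div, div_mul_eq_mul_div, div_le_iff₀ (by positivity)]
  linarith [key]

/-- **(D) for every real `q ≥ 2` and every `c ≤ B_q`**: `c(3u−1)‖A(u)‖^{q−2} ≤ u^{q−1}` on `[1/3, 2/3]`. [ours] -/
theorem lineD_of_le_axiB {q c : ℝ} (hq : 2 ≤ q) (hc : c ≤ axiB q) {u : ℝ} (hu1 : 1 / 3 ≤ u) (hu2 : u ≤ 2 / 3) :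
    c * (3 * u - 1) * lineNsq u ^ (q / 2 - 1) ≤ u ^ (q - 1) := by
  have hy : 0 ≤ 3 * u - 1 := by linarith
  have hsa : 0 ≤ lineNsq u ^ (q / 2 - 1) := (Real.rpow_pos_of_pos (lineNsq_pos u) _).le
  calc c * (3 * u - 1) * lineNsq u ^ (q / 2 - 1) ≤ axiB q * (3 * u - 1) * lineNsq u ^ (q / 2 - 1) :=
        mul_le_mul_of_nonneg_right (mul_le_mul_of_nonneg_right hc hy) hsa
    _ ≤ u ^ (q - 1) := lineD_axiB hq hu1 hu2

/-! ## 5. At the sharp share `c = c_axi(q)` -/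

/-- **(N⁺) at `c_axi(q)`, every real `q ≥ 2`**: `0 < lineN q (c_axi q) u` on `[1/3, 2/3]`. [ours] -/
theorem lineN_cAxi_pos {q : ℝ} (hq : 2 ≤ q) {u : ℝ} (hu1 : 1 / 3 ≤ u) (hu2 : u ≤ 2 / 3) : 0 < lineN q (cAxi q) u :=
  lineN_pos_of_lt_axiB hq (cAxi_lt_axiB (by linarith)) hu1 hu2

/-- **(D) at `c_axi(q)`, every real `q ≥ 2`**: `c_axi(q)(3u−1)‖A(u)‖^{q−2} ≤ u^{q−1}` on `[1/3, 2/3]`. [ours] -/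
theorem lineD_cAxi {q : ℝ} (hq : 2 ≤ q) {u : ℝ} (hu1 : 1 / 3 ≤ u) (hu2 : u ≤ 2 / 3) :
    cAxi q * (3 * u - 1) * lineNsq u ^ (q / 2 - 1) ≤ u ^ (q - 1) :=
  lineD_of_le_axiB hq (cAxi_lt_axiB (by linarith)).le hu1 hu2

end TopEig

end Summit.NavierStokesRegularity.FunctionalMining
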